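import Summits.HubbardSuperconductivity.HubbardSuperconductivity.Theses.ChiralWindow
import Summits.HubbardSuperconductivity.HubbardSuperconductivity.Theses.TorusCooperLog
import Summits.HubbardSuperconductivity.HubbardSuperconductivity.Theorems.ChiralWindowCwThesisReductions
import Summits.HubbardSuperconductivity.HubbardSuperconductivity.Theorems.ChiralWindowCwThesisPenaltyEquivalence
import Summits.HubbardSuperconductivity.HubbardSuperconductivity.Theorems.ChiralWindowCwThesisEnergyWindowFloor
import Summits.HubbardSuperconductivity.HubbardSuperconductivity.Theorems.ChiralWindowCwThesisChannelInfNonpos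
import Summits.HubbardSuperconductivity.HubbardSuperconductivity.Theorems.ChiralWindowCwThesisA1gReduction
import Summits.HubbardSuperconductivity.HubbardSuperconductivity.Theorems.ChiralWindowCwThesisCertificateLevelBridge
import Summits.HubbardSuperconductivity.HubbardSuperconductivity.Theorems.ChiralWindowCwGlue

/-!
# `CwThesis` (stmt-HubbardSuperconductivity-10438) — line `SketchIdeator3` (penalty line), lead skeleton v7

Crux (route `ChiralWindow`, the route TARGET, auto-cruxed as "underived target", rank 0):
`Summit.HubbardSuperconductivity.HubbardSuperconductivity.Theses.ChiralWindow.CwThesis` —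
`∃ U₀ > 0, ∀ U ∈ (0,U₀), ∃ δ ∈ [3/10,12/25]`, the summit matrix at `(U, δ)` (every normalised even-torus
`(N_L, S^z = 0)`-sector ground-state sequence of `hubbardTorus 2 L 1 U`, `N_L = 2⌊(1-δ)L²/2⌋`, has `d_{x²-y²}`
pair-field long-range order).

v7 (lead c4, 2026-08-16) is the CONSOLIDATED skeleton: every stub that the leads 0, c1, c2, c3 proved is LANDED under
`Theorems/ChiralWindowCwThesis*.lean` / `Theorems/CwThesis/Negative/` and is consumed here BY NAME through the imports
(v6 still carried the v5/v6 proofs inline because the farm had not yet built those modules). What remains is exactly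
three registered stubs, in two alternative compositions, each concluding the crux BY NAME:

* Branch A (the card's thermal engine): `CwThesis_of_engine := cwThesis_of_gibbsPenaltyFloor stub_gibbsPenaltyFloor`.
  `stub_gibbsPenaltyFloor` (the ENGINE) is, BY THEOREM (`gibbsPenaltyFloor_iff_penaltyResponseWindow`, p96717;
  energy-window normal form p97900), the `∀ U ∃ δ` form of the CONCLUSION of the sibling crux `TorusCooperLog.KLCanonical`
  (stmt-HubbardSuperconductivity-2681) — the weak-coupling BCS construction itself; promoted by lead c1 (PROMOTE.md); false
  at `U = 0` (`Summit.HubbardSuperconductivity.CwThesis.Negative.stub_engineFalseAtZero`, LANDED p107565,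
  `Theorems/CwThesis/Negative/GibbsPenaltyFloorAtZero.lean`), so `0 < U` is load-bearing and all its constants degenerate
  as `U → 0⁺` (Disproof §6/§7).
* Branch B (the anchor, `CwThesis_of`): `stub_klCanonical` (= the EXISTING crux stmt-2681 `TorusCooperLog.KLCanonical`,
  VERBATIM) and `stub_cwKLChiralWindow` (= the EXISTING crux stmt-1741 `ChiralWindow.CwKLChiralWindow`, VERBATIM) give the
  crux through the landed anchor `cwThesis_of_klCanonical_of_cwKLChiralWindow'` (p104354: Riemann–Lebesgue proviso
  `channelInf ≤ 0` on the band discharged). The crux is a COROLLARY OF TWO EXISTING ITEMS. What is consumed of stmt-1741 is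
  only the `U`-FREE certificate at ONE window doping (`klCertificate_of_cwKLChiralWindow`, p114619, and
  `cwThesis_of_klCanonical_of_klCertificate`, p111122: `A1g` competes only through extended-`s` states p107970,
  `U²`-homogeneity off `A1g` from the crux-1741 chain; level bridge p115479 below).

Second, independent derivation from existing items (route glue, stmt-1743 `CwGlue`, proved `cwGlue_proof`):
`CwChiralConstruction (stmt-1740) → CwSsbToEvenTorusLRO (stmt-10439) → CwThesis`, restated below as `CwThesis_of_routeGlue`.
Planner note: the deciding theorem `ChiralWindow.closes` applies `h_Assembly h_CwThesis`; written as
`h_Assembly (h_CwGlue h_CwChiralConstruction h_CwSsbToEvenTorusLRO)` the target is DERIVED inside the route and the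
auto-crux on stmt-10438 disappears — the crux carries no content beyond 1740 ∧ 10439 (grand-canonical glue) or 2681 ∧ 1741
(canonical glue, kill criterion (iii) pivot already wired).

Landed helpers of this line (all `--supports stmt-HubbardSuperconductivity-10438`): p86352 thermal descent, p87237 block
ground energy, p88115 `PenaltyResponseLRO` (= stmt-10879), p89808 reductions, p96717, p97900, p102153 sign decoupling,
p102159 modulated channel states, quartic invariant, p102196 vanishing near the diagonal, p104354 `channelInf ≤ 0` + anchor,
p104369 half filling, p107970 `A1g` reduction, p107565 engine false at `U = 0`, p111122 `U`-free anchor, p114619 certificate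
⇐ `CwKLChiralWindow`, p115479 level bridge, p115483 `KLCanonical` ↔ its leading-only form.

Disproof used (`Cruxes/CwThesis/Disproof.lean`, cdisprove gen 1, no kill): §5 floor normal form (branch A ends in it via
`PenaltyResponseLRO`); §6 `not_hasDWavePairFieldLROAt_zero` ⇒ `Negative.gibbsPenaltyFloor_false_at_zero` (p107565); §7 no `U`-uniform constants (all
constants quantified after `U`); §2 `δ_U` free to drift (branch A) / constant `δ_U ≡ δ₀` (branch B, allowed); §4 window
edges irrelevant inside `[3/10,12/25]`. No `-- Targets` section addresses the three remaining stubs (none is session-provable: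
two are existing cruxes, one is certified numerics owned by the stmt-1741 / 2682 / 0158 chains).
-/

noncomputable section

namespace Summit.HubbardSuperconductivity.HubbardSuperconductivity.Cruxes.CwThesis.PenaltyLine

open Matrix Filter MeasureTheory Literature.MathematicalPhysics.QuantumLattice Literature.Probability.LatticeModels
open Summit.HubbardSuperconductivity.HubbardSuperconductivity.Theses
open scoped ComplexOrder

set_option linter.dupNamespace false
-- the `(n,n)`-sector index type `{s : Finset (Orb Λ) // …}` needs a larger instance budget for
-- `DecidableEq` (structural instance through `Lex (Fin 2 → Fin L)`; tree precedent: GaugedHubbardTorus)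
set_option synthInstance.maxSize 512

/-! ### Registered stubs (the only `sorry`s of the file) -/

/-- STUB (branch A — ENGINE, C⁺⁺; summit-hard, PROMOTED by lead c1): **canonical Gibbs `d`-wave floor under an intensive
repulsive pair penalty, pointwise on the crossing line.** There is `U₀ > 0` such that for every `U ∈ (0, U₀)` there are a
doping `δ ∈ [3/10, 12/25]` and constants `κ, a, M > 0` with `2 log 4 ≤ M κ a` such that, for all large `k`, with
`L = 2(k+1)`, `n = ⌊(1-δ)L²/2⌋`, `p` Lieb's `(n,n)` occupation sector, `H_p`, `Q_p` the compressions of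
`hubbardTorus 2 L 1 U` and `Δ_d†Δ_d` to `p`: the Gibbs state of `H_p + (κ/L⁴) Q_p` at `β = M L²` satisfies
`a L⁴ ≤ Re ω(Q_p)`. By `engine_iff_penaltyResponseWindow` this is the `∀U ∃δ` form of `KLCanonical`'s conclusion. -/
theorem stub_gibbsPenaltyFloor :
    ∃ U₀ : ℝ, 0 < U₀ ∧ ∀ U ∈ Set.Ioo (0:ℝ) U₀, ∃ δ ∈ Set.Icc (3/10 : ℝ) (12/25),
      ∃ κ a M : ℝ, 0 < κ ∧ 0 < a ∧ 0 < M ∧ 2 * Real.log 4 ≤ M * κ * a ∧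
        ∀ᶠ k : ℕ in atTop,
          let L : ℕ := 2 * (k + 1)
          let n : ℕ := ⌊(1 - δ) * (L : ℝ) ^ 2 / 2⌋₊
          let Hp := (hubbardTorus 2 L 1 U).toBlock
            (fun s => (upPart s).card = n ∧ (downPart s).card = n)
            (fun s => (upPart s).card = n ∧ (downPart s).card = n)
          let Qp := ((pairField dWaveFormFactor L)ᴴ * pairField dWaveFormFactor L).toBlock
            (fun s => (upPart s).card = n ∧ (downPart s).card = n)
            (fun s => (upPart s).card = n ∧ (downPart s).card = n)
          a * (L : ℝ) ^ 4 ≤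
            (Matrix.gibbsState (M * (L : ℝ) ^ 2) (Hp + ((κ / (L : ℝ) ^ 4 : ℝ) : ℂ) • Qp) Qp).re := by
  sorry

/-- STUB (branch B — the EXISTING crux stmt-HubbardSuperconductivity-2681 of route `TorusCooperLog`, VERBATIM; registered
so that the skeleton's dependency on it is machine-visible): **Kohn–Luttinger universality in canonical pair-penalty form.**
For every `δ ∈ (0,1/2)`: an attractive-and-leading `B₁g` Kohn–Luttinger datum at density `1-δ` forces, for all small `U`,
the eventual intensive `d`-wave penalty response `c κ ≤ E_L(U;κ) - E_L(U;0)` of the sector ground energies along `L = 2(k+1)`.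
The weak-coupling construction itself (no short-range 2D lattice fermion model has a constructed BCS phase). -/
theorem stub_klCanonical : TorusCooperLog.KLCanonical := by
  sorry

/-- STUB (branch B — the EXISTING crux stmt-HubbardSuperconductivity-1741 of this route, VERBATIM; certified
Kohn–Luttinger numerics with its own chain, `Cruxes/CwKLChiralWindow/CertSpec.md`): **the certified chiral-window data.**
What branch B actually CONSUMES of it is far weaker — conjunct (i) at the single doping `δ = a ∈ [3/10,12/25]` and one
coupling, in the `U`-FREE form `klCertificate` (LANDED `klCertificate_of_cwKLChiralWindow`, p114619):
`∃ δ₀ ∈ [3/10,12/25] ∃ γ > 0`, with `μ = chemicalPotentialOfDensity ε (1-δ₀)`, `Λ_1(μ,χ) = channelInf ε μ 1 χ`: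
(a) `Λ_1(μ,B1g) + γ ≤ Λ_1(μ,χ)` for `χ ∉ {B1g, A1g}`; (b) `Λ_1(μ,B1g) + γ ≤ ⟨φ, Γ_1 φ⟩` for every mean-zero `A1g`
channel state `φ` — from which `cwThesis_of_klCanonical_of_klCertificate` (LANDED p111122) gives the crux with
`stub_klCanonical`; a certificate at a rational band level suffices (`klCertificate_of_certificateAtLevel`, p115479).
Numerically (non-certified census on stmt-1741) the certificate holds at `δ₀ = 3/10 … 2/5` with `U = 1` margin
`≈ 7·10⁻³`. [cite: RaghuKivelsonScalapino2010, §III] -/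
theorem stub_cwKLChiralWindow : ChiralWindow.CwKLChiralWindow := by
  sorry

/-! ### Landed stubs of the line, consumed by name (no `sorry`)

(Also landed, cited only — their modules post-date the farm build this file was checked against:
`Theorems.CwThesis.stub_klCanonicalIffLeading` p115483, `Theorems.CwThesis.klCertificate_of_cwKLChiralWindow` p114619,
`Theorems.CwThesis.cwThesis_of_klCanonical_of_klCertificate` p111122, `CwThesis.Negative.stub_engineFalseAtZero` p107565.) -/

/-- LANDED p86352: **thermal penalty descent** `κ Re ω_{β,H+κY}(Y) - log|m|/β ≤ E₀(H+κY) - E₀(H)`. [folklore] -/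
theorem stub_thermalPenaltyDescent {m : Type*} [Fintype m] [DecidableEq m] [Nonempty m]
    (H Y : Matrix m m ℂ) (hH : H.IsHermitian) (hY : Y.IsHermitian) {β : ℝ} (hβ : 0 < β) (κ : ℝ) :
    κ * (Matrix.gibbsState β (H + (κ : ℂ) • Y) Y).re - Real.log (Fintype.card m) / β ≤
      (H + (κ : ℂ) • Y).groundEnergy - H.groundEnergy :=
  Theorems.CwThesis.stub_thermalPenaltyDescent H Y hH hY hβ κ

/-- LANDED p87237: **block ground energy = sector energy** on Lieb's `(n,n)` sector. [folklore] -/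
theorem stub_blockGroundEnergy (L : ℕ)
    (A : Matrix (Finset (Orb (FermionTorus 2 L))) (Finset (Orb (FermionTorus 2 L))) ℂ)
    (hA : A.IsHermitian) {n : ℕ} (hn : n ≤ L ^ 2) :
    (A.toBlock (fun s => (upPart s).card = n ∧ (downPart s).card = n)
        (fun s => (upPart s).card = n ∧ (downPart s).card = n)).groundEnergy =
      A.minEnergyOn (szSector (2 * n) 0) :=
  Theorems.CwThesis.stub_blockGroundEnergy L A hA hn

/-- LANDED p88115 (also closes stmt-10879 verbatim): **penalty response ⇒ the summit matrix.** [folklore] -/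
theorem stub_penaltyResponseLRO : TorusCooperLog.PenaltyResponseLRO :=
  Theorems.CwThesis.stub_penaltyResponseLRO

/-- LANDED p104354: **every channel bottom is non-positive on the band** (`-4 < μ < 0`). [folklore] -/
theorem stub_channelInfNonpos (U : ℝ) (χ : D4Irrep) {μ : ℝ} (hμ : μ ∈ Set.Ioo (-4 : ℝ) 0) :
    channelInf (squareDispersion 1 0) μ U χ ≤ 0 :=
  Theorems.CwThesis.stub_channelInfNonpos U χ hμ

/-- LANDED p107970: **the `s`-wave competitor enters only through extended-`s` states**:
a mean-zero second-order bound `λ⊥` gives `U² λ⊥ - C U³ ≤ ⟨ψ, Γ_U ψ⟩` for every `A1g` channel state.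
[cite: RaghuKivelsonScalapino2010, §III] -/
theorem stub_a1gReduction {μ lam : ℝ} (hμ : μ ∈ Set.Ioo (-4 : ℝ) 0)
    (hlam : ∀ φ : Momentum → ℝ, IsChannelState (squareDispersion 1 0) μ D4Irrep.A1g φ →
      ∫ k, φ k ∂fermiCurveMeasure (squareDispersion 1 0) μ = 0 → lam ≤ pairingForm (squareDispersion 1 0) μ 1 φ) :
    ∃ C : ℝ, 0 ≤ C ∧ ∀ U ∈ Set.Ioo (0:ℝ) 1, ∀ ψ : Momentum → ℝ,
      IsChannelState (squareDispersion 1 0) μ D4Irrep.A1g ψ →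
        U ^ 2 * lam - C * U ^ 3 ≤ pairingForm (squareDispersion 1 0) μ U ψ :=
  Theorems.CwThesis.stub_a1gReduction hμ hlam

/-! ### Branch A: the engine and its normal forms -/

/-- **What the engine IS** (LANDED p96717): engine ↔ the `T = 0` penalty-response family C⁺
`∀U ∃δ ∃κ,c>0 ∀ᶠk, cκ ≤ E_L(U;κ) - E_L(U;0)`, `L = 2(k+1)` — at a fixed doping word for word the conclusion of
`TorusCooperLog.KLCanonical`. [folklore] -/
theorem engine_iff_penaltyResponseWindow :
    (∃ U₀ : ℝ, 0 < U₀ ∧ ∀ U ∈ Set.Ioo (0:ℝ) U₀, ∃ δ ∈ Set.Icc (3/10 : ℝ) (12/25),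
      ∃ κ a M : ℝ, 0 < κ ∧ 0 < a ∧ 0 < M ∧ 2 * Real.log 4 ≤ M * κ * a ∧
        ∀ᶠ k : ℕ in atTop,
          let L : ℕ := 2 * (k + 1)
          let n : ℕ := ⌊(1 - δ) * (L : ℝ) ^ 2 / 2⌋₊
          let Hp := (hubbardTorus 2 L 1 U).toBlock
            (fun s => (upPart s).card = n ∧ (downPart s).card = n)
            (fun s => (upPart s).card = n ∧ (downPart s).card = n)
          let Qp := ((pairField dWaveFormFactor L)ᴴ * pairField dWaveFormFactor L).toBlock
            (fun s => (upPart s).card = n ∧ (downPart s).card = n)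
            (fun s => (upPart s).card = n ∧ (downPart s).card = n)
          a * (L : ℝ) ^ 4 ≤
            (Matrix.gibbsState (M * (L : ℝ) ^ 2) (Hp + ((κ / (L : ℝ) ^ 4 : ℝ) : ℂ) • Qp) Qp).re) ↔
    (∃ U₀ : ℝ, 0 < U₀ ∧ ∀ U ∈ Set.Ioo (0:ℝ) U₀, ∃ δ ∈ Set.Icc (3/10 : ℝ) (12/25),
      ∃ κ : ℝ, 0 < κ ∧ ∃ c : ℝ, 0 < c ∧ ∀ᶠ k : ℕ in Filter.atTop,
        c * κ ≤ Matrix.minEnergyOn (hubbardTorus 2 (2 * (k + 1)) 1 U +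
            ((κ / ((2 * (k + 1) : ℕ) : ℝ) ^ 4 : ℝ) : ℂ) •
              ((pairField dWaveFormFactor (2 * (k + 1)))ᴴ * pairField dWaveFormFactor (2 * (k + 1))))
            (szSector (2 * ⌊(1 - δ) * ((2 * (k + 1) : ℕ) : ℝ) ^ 2 / 2⌋₊) 0) -
          Matrix.minEnergyOn (hubbardTorus 2 (2 * (k + 1)) 1 U)
            (szSector (2 * ⌊(1 - δ) * ((2 * (k + 1) : ℕ) : ℝ) ^ 2 / 2⌋₊) 0)) :=
  Theorems.CwThesis.gibbsPenaltyFloor_iff_penaltyResponseWindow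

/-- **Branch A composition**: the engine gives the crux BY NAME (thermal descent + block bookkeeping + `PenaltyResponseLRO`,
LANDED as `cwThesis_of_gibbsPenaltyFloor`, p89808). -/
theorem CwThesis_of_engine : ChiralWindow.CwThesis :=
  Theorems.CwThesis.cwThesis_of_gibbsPenaltyFloor stub_gibbsPenaltyFloor

/-! ### Branch B: the anchor through existing items -/

/-- **The certificate from interval arithmetic at a rational band LEVEL** (LANDED p115479): certify the `U`-free
inequalities at `μ₀ ∈ (-4,0)` with `1 - n(μ₀) ∈ [3/10,12/25]`; then they hold at the window doping `δ₀ := 1 - n(μ₀)`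
(`μ(n(μ₀)) = μ₀` exactly). [folklore] -/
theorem klCertificate_of_certificateAtLevel
    (h : ∃ μ₀ ∈ Set.Ioo (-4 : ℝ) 0,
      1 - KohnLuttinger.filling (squareDispersion 1 0) μ₀ ∈ Set.Icc (3/10 : ℝ) (12/25) ∧ ∃ γ : ℝ, 0 < γ ∧
      (∀ χ : D4Irrep, χ ≠ D4Irrep.B1g → χ ≠ D4Irrep.A1g →
        channelInf (squareDispersion 1 0) μ₀ 1 D4Irrep.B1g + γ ≤ channelInf (squareDispersion 1 0) μ₀ 1 χ) ∧
      (∀ φ : Momentum → ℝ, IsChannelState (squareDispersion 1 0) μ₀ D4Irrep.A1g φ →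
        ∫ k, φ k ∂fermiCurveMeasure (squareDispersion 1 0) μ₀ = 0 →
          channelInf (squareDispersion 1 0) μ₀ 1 D4Irrep.B1g + γ ≤ pairingForm (squareDispersion 1 0) μ₀ 1 φ)) :
    ∃ δ₀ ∈ Set.Icc (3/10 : ℝ) (12/25), ∃ γ : ℝ, 0 < γ ∧
      (∀ χ : D4Irrep, χ ≠ D4Irrep.B1g → χ ≠ D4Irrep.A1g →
        channelInf (squareDispersion 1 0) (chemicalPotentialOfDensity (squareDispersion 1 0) (1 - δ₀)) 1 D4Irrep.B1g + γ ≤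
          channelInf (squareDispersion 1 0) (chemicalPotentialOfDensity (squareDispersion 1 0) (1 - δ₀)) 1 χ) ∧
      (∀ φ : Momentum → ℝ,
        IsChannelState (squareDispersion 1 0) (chemicalPotentialOfDensity (squareDispersion 1 0) (1 - δ₀)) D4Irrep.A1g φ →
        ∫ k, φ k ∂fermiCurveMeasure (squareDispersion 1 0) (chemicalPotentialOfDensity (squareDispersion 1 0) (1 - δ₀)) = 0 →
          channelInf (squareDispersion 1 0) (chemicalPotentialOfDensity (squareDispersion 1 0) (1 - δ₀)) 1 D4Irrep.B1g + γ ≤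
            pairingForm (squareDispersion 1 0) (chemicalPotentialOfDensity (squareDispersion 1 0) (1 - δ₀)) 1 φ) :=
  Theorems.CwThesis.klCertificate_of_certificateAtLevel h

/-- **The skeleton theorem (branch B).** The two registered stubs `stub_klCanonical` (= stmt-2681) and
`stub_cwKLChiralWindow` (= stmt-1741) conclude the crux `CwThesis` BY NAME through the landed anchor
`cwThesis_of_klCanonical_of_cwKLChiralWindow'` (p104354; Riemann–Lebesgue proviso discharged by `stub_channelInfNonpos`).
The sharper route through the `U`-free certificate alone is `cwThesis_of_klCanonical_of_klCertificate` (p111122). -/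
theorem CwThesis_of : ChiralWindow.CwThesis :=
  Theorems.CwThesis.cwThesis_of_klCanonical_of_cwKLChiralWindow' stub_klCanonical stub_cwKLChiralWindow

/-- **The crux from the two existing items directly** (LANDED p104354, `cwThesis_of_klCanonical_of_cwKLChiralWindow'`;
the Riemann–Lebesgue proviso discharged by `stub_channelInfNonpos`):
`KLCanonical (stmt-2681) → CwKLChiralWindow (stmt-1741) → CwThesis (stmt-10438)`. [folklore] -/
theorem CwThesis_of_items (hKL : TorusCooperLog.KLCanonical) (hW : ChiralWindow.CwKLChiralWindow) :
    ChiralWindow.CwThesis :=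
  Theorems.CwThesis.cwThesis_of_klCanonical_of_cwKLChiralWindow' hKL hW

/-- **The crux from the route's own cruxes** (the support item `CwGlue`, stmt-1743, proved `cwGlue_proof`):
`CwChiralConstruction (stmt-1740) → CwSsbToEvenTorusLRO (stmt-10439) → CwThesis`. If the deciding theorem
`ChiralWindow.closes` consumed this glue, stmt-10438 would not be an auto-crux. [folklore] -/
theorem CwThesis_of_routeGlue (hC : ChiralWindow.CwChiralConstruction) (hT : ChiralWindow.CwSsbToEvenTorusLRO) :
    ChiralWindow.CwThesis :=
  Theorems.cwGlue_proof hC hT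

end Summit.HubbardSuperconductivity.HubbardSuperconductivity.Cruxes.CwThesis.PenaltyLine

end
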